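import Mathlib
import Summits.Ventures.HodgeRepro2.T5EmbeddingRestriction

/-!
# T5DegreeOneUnder — «p splits completely in E ⇒ p splits completely in the subfield F»

Tier-5 support (seat p7, cell pub-hodge-repro2), seventh file of the embedding chain, for
route/T5-CHECK-G-p7.md S0: the datum gives a prime of the sextic `E` of degree one over `p`, while
rows P1.2 / P1.4 / P1.9 (`[F_𝔭 : ℚ_p] = 1`, `p ∤ D_F`; row 11's `unr_of_isGalois_of_degree_one`)
are stated for the cubic subfield `F` and consume a degree-one prime of `F`.  This file supplies
it: the prime of `𝓞 F` BELOW a degree-one prime `𝔓` of `𝓞 E` has degree one (`degree_one_under`),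
and «every prime of `E` above `p` has degree one» passes to `F` (`forall_degree_one_under`).
The proof is the embedding chain's: `𝔓` gives an embedding `E → ℚ_p`, which restricts to an
embedding `F → ℚ_p`, which induces a prime of degree one — and that prime is `𝔓 ∩ 𝓞 F`.
-/

namespace Summit.Ventures.HodgeRepro2.T5DegreeOneUnder

open IsDedekindDomain NumberField T5DegreeOneEmbeddings T5EmbeddingPrimeEquiv
  T5EmbeddingRestriction

variable {F E : Type*} [Field F] [NumberField F] [Field E] [NumberField E] [Algebra F E]
  {p : ℕ} [hp : Fact p.Prime]

section prime

variable (F) (p) (𝔓 : HeightOneSpectrum (𝓞 E)) [h𝔓 : 𝔓.asIdeal.LiesOver (Ideal.span {(p : ℤ)})]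
  (hdeg : 𝔓.asIdeal.ramificationIdx ℤ * 𝔓.asIdeal.inertiaDeg ℤ = 1)

/-- The prime of `𝓞 F` below a degree-one prime `𝔓` of `𝓞 E`, as a height-one prime: the prime
induced by the restriction to `F` of the embedding attached to `𝔓`. -/
noncomputable def under : HeightOneSpectrum (𝓞 F) :=
  inducedPrime (restrictEmb (F := F) (embedding 𝔓 p hdeg))

/-- `(under 𝔓).asIdeal = 𝔓 ∩ 𝓞 F`. -/
theorem under_asIdeal : (under F p 𝔓 hdeg).asIdeal = 𝔓.asIdeal.under (𝓞 F) := by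
  rw [under, inducedPrime_restrictEmb, inducedPrime_embedding]

/-- The prime below lies over `p`. -/
instance under_liesOver : (under F p 𝔓 hdeg).asIdeal.LiesOver (Ideal.span {(p : ℤ)}) :=
  inducedPrime_liesOver _

/-- **The prime below a degree-one prime has degree one.** -/
theorem degree_one_under :
    (under F p 𝔓 hdeg).asIdeal.ramificationIdx ℤ * (under F p 𝔓 hdeg).asIdeal.inertiaDeg ℤ = 1 :=
  degree_one_inducedPrime _

/-- `𝔓` lies over the prime below it. -/
instance liesOver_under : 𝔓.asIdeal.LiesOver (under F p 𝔓 hdeg).asIdeal :=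
  ⟨under_asIdeal F p 𝔓 hdeg⟩

end prime

/-- **«p splits completely in E ⇒ p splits completely in F»**: if every prime of `E` above `p`
has degree one, so does every prime of `F` above `p` (each lies below some prime of `E`). -/
theorem forall_degree_one_under
    (hsplit : ∀ w : HeightOneSpectrum (𝓞 E), w.asIdeal.LiesOver (Ideal.span {(p : ℤ)}) →
      w.asIdeal.ramificationIdx ℤ * w.asIdeal.inertiaDeg ℤ = 1)
    (𝔭 : HeightOneSpectrum (𝓞 F)) (h𝔭 : 𝔭.asIdeal.LiesOver (Ideal.span {(p : ℤ)})) :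
    𝔭.asIdeal.ramificationIdx ℤ * 𝔭.asIdeal.inertiaDeg ℤ = 1 := by
  haveI := h𝔭
  obtain ⟨Q, hQmax, hQ⟩ := Ideal.exists_maximal_ideal_liesOver_of_isIntegral (S := 𝓞 E) 𝔭.asIdeal
  haveI : Q.IsPrime := hQmax.isPrime
  haveI := hQ
  set 𝔓 : HeightOneSpectrum (𝓞 E) := primeAbove 𝔭 Q with h𝔓
  have hdeg : 𝔓.asIdeal.ramificationIdx ℤ * 𝔓.asIdeal.inertiaDeg ℤ = 1 :=
    hsplit 𝔓 (primeAbove_liesOver 𝔭 Q)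
  have hunder : under F p 𝔓 hdeg = 𝔭 := by
    apply HeightOneSpectrum.ext
    rw [under_asIdeal, h𝔓, primeAbove_asIdeal]
    exact hQ.over.symm
  rw [← hunder]
  exact degree_one_under F p 𝔓 hdeg

/-- The Galois form: `E/ℚ` Galois with one degree-one prime above `p` ⇒ every prime of the
subfield `F` above `p` has degree one (rows 11 / 12 for `F`, fed by the datum's prime of `E`). -/
theorem forall_degree_one_under_of_isGalois [IsGalois ℚ E] (w₀ : HeightOneSpectrum (𝓞 E))
    [hw₀ : w₀.asIdeal.LiesOver (Ideal.span {(p : ℤ)})]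
    (hdeg₀ : w₀.asIdeal.ramificationIdx ℤ * w₀.asIdeal.inertiaDeg ℤ = 1)
    (𝔭 : HeightOneSpectrum (𝓞 F)) (h𝔭 : 𝔭.asIdeal.LiesOver (Ideal.span {(p : ℤ)})) :
    𝔭.asIdeal.ramificationIdx ℤ * 𝔭.asIdeal.inertiaDeg ℤ = 1 :=
  forall_degree_one_under (forall_degree_one_of_isGalois E p w₀ hdeg₀) 𝔭 h𝔭

end Summit.Ventures.HodgeRepro2.T5DegreeOneUnder
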